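import Mathlib
import Summits.Ventures.PercRepro.PuncturedLYMSplit
import Summits.Ventures.PercRepro.PuncturedLYMCoHyp

/-!
# PercRepro — (SP) BY POINT SPLITTING: THE ONE-CO-HYPERPLANE THEOREM ON ANY GROUND SET WITH `j + 2 ≤ n`
(p10, gen 36)

The instance of ONE co-hyperplane `C ⊆ S` (`1 ≤ #C ≤ j`): the rows are the `j`-subsets of `S` not containing `C`
(`rowsOne S j C`), the columns all `(j+1)`-subsets, uniform row mass `ρ` and column demand `ν` with `ρ·#P = ν·#Y`.
THE RECURSION (PuncturedLYMSplit): split at a point `x ∈ C`.  Every `j`-subset of `S ∖ x` is a row (it cannot contain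
`C`), so the `x`-free half is the FREE instance (`hasFlow_free`) with row mass `ρ − κ`; the `x`-half is the instance of
`C ∖ x` on `S ∖ x` at level `j − 1` with column demand `ν − κ` (every column of the `x`-half received a cross edge);
`κ = t/#P₀` with the excess `t = ρ·#P₀ − ν·#Y₀`.  The two constraints are `0 ≤ κ` — the binomial inequality
`C(n−1, j)·C(n, j+1) ≥ C(n, j)·C(n−1, j+1)` — and `κ ≤ ν`, which is AUTOMATIC: `κ ≤ ν ⟺ ρ·#P₀ ≤ ν·#Y = ρ·#P`.
Induction on `#C`; the base `C = ∅` has no rows and zero demand.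

* `hasFlow_rowsOne` — `HasFlow S j (rowsOne S j C) ρ ν` for every `C ⊆ S` with `#C ≤ j`, `j + 2 ≤ #S`, `ρ, ν ≥ 0`
  and `ρ·#P = ν·#Y`;
* `puncturedNMP_upLevel_split` — (SP) for `D = upLevel j C` on the whole type, `1 ≤ #C ≤ j`, `j + 2 ≤ #α`: a second,
  independent proof of gen 33's `puncturedNMP_upLevel` with the hypothesis `2j + 1 ≤ n` weakened to `j + 2 ≤ n`.
-/

namespace PercRepro.PuncturedLYM.Split

open Finset

variable {α : Type} [DecidableEq α]

/-- The rows of the one-co-hyperplane instance: the `j`-subsets of `S` not containing `C`. -/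
def rowsOne (S : Finset α) (j : ℕ) (C : Finset α) : Finset (Finset α) :=
  (S.powersetCard j).filter (fun X => ¬ C ⊆ X)

/-- Membership in `rowsOne`. -/
theorem mem_rowsOne {S C X : Finset α} {j : ℕ} : X ∈ rowsOne S j C ↔ X ⊆ S ∧ X.card = j ∧ ¬ C ⊆ X := by
  simp [rowsOne, mem_powersetCard, and_assoc]

/-- The rows are `j`-subsets of `S`. -/
theorem rowsOne_subset (S : Finset α) (j : ℕ) (C : Finset α) : rowsOne S j C ⊆ S.powersetCard j :=
  filter_subset _ _

/-- No row when `C = ∅`. -/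
theorem rowsOne_empty (S : Finset α) (j : ℕ) : rowsOne S j (∅ : Finset α) = ∅ := by
  ext X; simp [mem_rowsOne]

/-- For `x ∈ C` the `x`-free rows are ALL `j`-subsets of `S ∖ x`. -/
theorem rowsFree_rowsOne {S C : Finset α} {j : ℕ} {x : α} (hxC : x ∈ C) :
    rowsFree (rowsOne S j C) x = (S.erase x).powersetCard j := by
  ext X
  simp only [mem_rowsFree, mem_rowsOne, mem_powersetCard, subset_erase]
  constructor
  · rintro ⟨⟨hXS, hXc, _⟩, hxX⟩; exact ⟨⟨hXS, hxX⟩, hXc⟩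
  · rintro ⟨⟨hXS, hxX⟩, hXc⟩; exact ⟨⟨hXS, hXc, fun h => hxX (h hxC)⟩, hxX⟩

/-- For `x ∈ C ⊆ S` and `0 < j` the `x`-half rows are the rows of `C ∖ x` on `S ∖ x` at level `j − 1`. -/
theorem rowsLink_rowsOne {S C : Finset α} {j : ℕ} (hj : 0 < j) {x : α} (hx : x ∈ S) (hxC : x ∈ C) :
    rowsLink (rowsOne S j C) x = rowsOne (S.erase x) (j - 1) (C.erase x) := by
  ext X'
  simp only [mem_rowsLink, mem_rowsOne, subset_erase]
  constructor
  · rintro ⟨hxX', hXS, hXc, hCX⟩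
    have hX'S : X' ⊆ S := (subset_insert x X').trans hXS
    refine ⟨⟨hX'S, hxX'⟩, ?_, ?_⟩
    · rw [card_insert_of_notMem hxX'] at hXc; omega
    · intro h
      apply hCX
      intro c hc
      by_cases hcx : c = x
      · subst hcx; exact mem_insert_self c X'
      · exact mem_insert_of_mem (h (mem_erase.2 ⟨hcx, hc⟩))
  · rintro ⟨⟨hX'S, hxX'⟩, hX'c, hCX'⟩
    refine ⟨hxX', insert_subset hx hX'S, ?_, ?_⟩
    · rw [card_insert_of_notMem hxX', hX'c]; omega
    · intro h
      apply hCX'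
      intro c hc
      have hcX : c ∈ insert x X' := h (mem_erase.1 hc).2
      rcases mem_insert.1 hcX with hcx | hcX'
      · exact absurd hcx (mem_erase.1 hc).1
      · exact hcX'

/-- Every column of the `x`-half (`x ∈ C`) is an `x`-free row: the cross edge exists. -/
theorem cols_erase_subset_rowsOne {S C : Finset α} {j : ℕ} (hj : 0 < j) {x : α} (hxC : x ∈ C) :
    cols (S.erase x) (j - 1) ⊆ rowsOne S j C := by
  intro Y hY
  rw [mem_cols, subset_erase] at hY
  rw [mem_rowsOne]
  refine ⟨hY.1.1, by omega, fun h => hY.1.2 (h hxC)⟩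

/-- A flow only sees `ρ` on the rows and `ν` on the columns. -/
theorem hasFlow_congr {S : Finset α} {j : ℕ} {P : Finset (Finset α)} {ρ ρ' ν ν' : Finset α → ℚ}
    (hρ : ∀ X ∈ P, ρ X = ρ' X) (hν : ∀ Y ∈ cols S j, ν Y = ν' Y) (h : HasFlow S j P ρ ν) :
    HasFlow S j P ρ' ν' := by
  obtain ⟨w, hw⟩ := h
  exact ⟨w, hw.nonneg, fun X hX => (hw.row X hX).trans (hρ X hX), fun Y hY => (hw.col Y hY).trans (hν Y hY)⟩

/-- The binomial inequality of the excess: `C(n, j)·C(n−1, j+1) ≤ C(n−1, j)·C(n, j+1)`. -/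
theorem choose_excess_ineq (n j : ℕ) (hn : j + 1 ≤ n) :
    n.choose j * (n - 1).choose (j + 1) ≤ (n - 1).choose j * n.choose (j + 1) := by
  have h1 : n.choose (j + 1) * (j + 1) = n.choose j * (n - j) := Nat.choose_succ_right_eq n j
  have h2 : (n - 1).choose (j + 1) * (j + 1) = (n - 1).choose j * (n - 1 - j) := Nat.choose_succ_right_eq (n - 1) j
  have key : n.choose j * (n - 1).choose (j + 1) * (j + 1) ≤ (n - 1).choose j * n.choose (j + 1) * (j + 1) := by
    calc n.choose j * (n - 1).choose (j + 1) * (j + 1) = n.choose j * ((n - 1).choose (j + 1) * (j + 1)) := by ring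
      _ = n.choose j * ((n - 1).choose j * (n - 1 - j)) := by rw [h2]
      _ ≤ n.choose j * ((n - 1).choose j * (n - j)) := by
          apply Nat.mul_le_mul_left; apply Nat.mul_le_mul_left; omega
      _ = (n - 1).choose j * (n.choose j * (n - j)) := by ring
      _ = (n - 1).choose j * (n.choose (j + 1) * (j + 1)) := by rw [h1]
      _ = (n - 1).choose j * n.choose (j + 1) * (j + 1) := by ring
  exact Nat.le_of_mul_le_mul_right key (Nat.succ_pos j)

/-- The `x`-free rows and the `x`-half rows partition the rows: `#P = #P₀ + #P₁`. -/
theorem card_rowsFree_add_card_rowsLink (P : Finset (Finset α)) (x : α) :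
    (rowsFree P x).card + (rowsLink P x).card = P.card := by
  have h : (rowsLink P x).card = (P.filter (fun X => x ∈ X)).card := by
    unfold rowsLink
    apply card_image_of_injOn
    intro X hX X' hX' h
    rw [mem_coe, mem_filter] at hX hX'
    simp only at h
    rw [← insert_erase hX.2, h, insert_erase hX'.2]
  rw [h]
  have key := card_filter_add_card_filter_not (s := P) (fun X => x ∉ X)
  simp only [not_not] at key
  exact key

/-- **THE ONE-CO-HYPERPLANE THEOREM BY POINT SPLITTING.** For `C ⊆ S` with `#C ≤ j` and `j + 2 ≤ #S`, the uniform
instance on the `j`-subsets of `S` not containing `C` (row mass `ρ ≥ 0`, column demand `ν ≥ 0`, `ρ·#P = ν·#Y`) has a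
flow.  Induction on `#C`: split at a point of `C`; the `x`-free half is free, the `x`-half is the instance of `C ∖ x`. -/
theorem hasFlow_rowsOne (m : ℕ) : ∀ (S : Finset α) (j : ℕ) (C : Finset α) (ρ ν : ℚ), C.card = m → C ⊆ S →
    m ≤ j → j + 2 ≤ S.card → 0 ≤ ρ → 0 ≤ ν → ρ * (rowsOne S j C).card = ν * (cols S j).card →
    HasFlow S j (rowsOne S j C) (fun _ => ρ) (fun _ => ν) := by
  induction m with
  | zero =>
    intro S j C ρ ν hC hCS hmj hn hρ hν htot
    rw [card_eq_zero] at hC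
    subst hC
    rw [rowsOne_empty] at htot ⊢
    have hpos : (0 : ℚ) < (cols S j).card := by
      rw [cols, card_powersetCard]
      exact_mod_cast Nat.choose_pos (by omega)
    have hν0 : ν = 0 := by
      rw [card_empty, Nat.cast_zero, mul_zero] at htot
      rcases mul_eq_zero.1 htot.symm with h | h
      · exact h
      · exact absurd h hpos.ne'
    refine ⟨fun _ _ => 0, fun _ _ => le_rfl, fun X hX => absurd hX (notMem_empty X), fun Y _ => ?_⟩
    simp [subs, hν0]
  | succ m ih =>
    intro S j C ρ ν hC hCS hmj hn hρ hν htot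
    obtain ⟨x, hxC⟩ : C.Nonempty := by rw [← card_pos, hC]; omega
    have hx : x ∈ S := hCS hxC
    have hj : 0 < j := by omega
    have hn1 : (S.erase x).card = S.card - 1 := card_erase_of_mem hx
    -- the counts
    have hP0 : (rowsFree (rowsOne S j C) x).card = (S.card - 1).choose j := by
      rw [rowsFree_rowsOne hxC, card_powersetCard, hn1]
    have hL0 : (cols (S.erase x) j).card = (S.card - 1).choose (j + 1) := by
      rw [cols, card_powersetCard, hn1]
    have hL : (cols S j).card = S.card.choose (j + 1) := card_powersetCard _ _
    have hL1 : (cols (S.erase x) (j - 1)).card = (S.card - 1).choose j := by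
      rw [cols, card_powersetCard, hn1]; congr 1; omega
    have hLsplit : S.card.choose (j + 1) = (S.card - 1).choose j + (S.card - 1).choose (j + 1) := by
      have := Nat.choose_succ_succ' (S.card - 1) j
      rwa [Nat.sub_add_cancel (by omega : 1 ≤ S.card)] at this
    have ha : 0 < (S.card - 1).choose j := Nat.choose_pos (by omega)
    have hb : 0 < (S.card - 1).choose (j + 1) := Nat.choose_pos (by omega)
    set a : ℚ := ((S.card - 1).choose j : ℚ) with ha_def
    set b : ℚ := ((S.card - 1).choose (j + 1) : ℚ) with hb_def
    have ha' : (0 : ℚ) < a := by rw [ha_def]; exact_mod_cast ha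
    have hb' : (0 : ℚ) < b := by rw [hb_def]; exact_mod_cast hb
    have hLq : ((cols S j).card : ℚ) = a + b := by rw [hL, hLsplit]; push_cast; rfl
    have hLpos : (0 : ℚ) < (cols S j).card := by rw [hLq]; linarith
    -- the rows: #P = a + #P₁, and a ≤ #P
    have hPsplit : ((rowsOne S j C).card : ℚ) = a + (rowsLink (rowsOne S j C) x).card := by
      rw [← card_rowsFree_add_card_rowsLink (rowsOne S j C) x, hP0]; push_cast; rfl
    have hPle : ((rowsOne S j C).card : ℚ) ≤ S.card.choose j := by
      exact_mod_cast (card_le_card (rowsOne_subset S j C)).trans (card_powersetCard j S).le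
    -- the excess `t` and the cross mass `κ`
    set t : ℚ := ρ * a - ν * b with ht_def
    set κ : ℚ := t / a with hκ_def
    have hbin : (S.card.choose j : ℚ) * b ≤ a * (cols S j).card := by
      rw [hL, ha_def, hb_def]; exact_mod_cast choose_excess_ineq S.card j (by omega)
    have ht : 0 ≤ t := by
      have h1 : t * (cols S j).card = ρ * (a * (cols S j).card - S.card.choose j * b)
          + ρ * b * (S.card.choose j - (rowsOne S j C).card) := by
        rw [ht_def]; linear_combination b * htot
      have h2 : 0 ≤ t * (cols S j).card := by
        rw [h1]
        apply add_nonneg (mul_nonneg hρ (sub_nonneg.2 hbin))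
        exact mul_nonneg (mul_nonneg hρ hb'.le) (sub_nonneg.2 hPle)
      exact (mul_nonneg_iff_of_pos_right hLpos).1 h2
    have hκ : 0 ≤ κ := div_nonneg ht ha'.le
    have hκa : κ * a = t := by rw [hκ_def]; field_simp
    have hκν : κ ≤ ν := by
      rw [hκ_def, div_le_iff₀ ha', ht_def]
      have : ρ * a ≤ ν * (a + b) := by
        rw [← hLq, ← htot]
        apply mul_le_mul_of_nonneg_left _ hρ
        rw [hPsplit]; linarith [(Nat.cast_nonneg (rowsLink (rowsOne S j C) x).card : (0 : ℚ) ≤ _)]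
      linarith
    have hρκ : 0 ≤ ρ - κ := by
      have : (ρ - κ) * a = ν * b := by rw [sub_mul, hκa, ht_def]; ring
      have h2 : 0 ≤ (ρ - κ) * a := by rw [this]; exact mul_nonneg hν hb'.le
      exact (mul_nonneg_iff_of_pos_right ha').1 h2
    -- glue
    apply hasFlow_glue (rowsOne_subset S j C) hj hx hκ
    · -- the `x`-free half is free
      rw [rowsFree_rowsOne hxC]
      have hjn : j < (S.erase x).card := by omega
      refine hasFlow_congr (fun _ _ => rfl) ?_ (hasFlow_free (S.erase x) j hjn (ρ - κ) hρκ)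
      intro Y _
      -- ν = (j+1)(ρ−κ)/(n−1−j) from (ρ−κ)·a = ν·b and b·(j+1) = a·(n−1−j)
      have h1 : (ρ - κ) * a = ν * b := by rw [sub_mul, hκa, ht_def]; ring
      have h2 : b * (j + 1) = a * ((S.card - 1 : ℕ) - j : ℕ) := by
        rw [ha_def, hb_def]; exact_mod_cast Nat.choose_succ_right_eq (S.card - 1) j
      have h3 : ((S.erase x).card : ℚ) - j = (((S.card - 1 : ℕ) - j : ℕ) : ℚ) := by
        have hsub : (S.card - 1 : ℕ) - j = S.card - (j + 1) := by omega
        rw [hn1, hsub, Nat.cast_sub (by omega : 1 ≤ S.card), Nat.cast_sub (by omega : j + 1 ≤ S.card)]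
        push_cast; ring
      have hpos : (0 : ℚ) < (((S.card - 1 : ℕ) - j : ℕ) : ℚ) := by
        have : 0 < (S.card - 1 : ℕ) - j := by omega
        exact_mod_cast this
      rw [h3, div_eq_iff hpos.ne']
      symm
      calc ν * (((S.card - 1 : ℕ) - j : ℕ) : ℚ) = (ν * b) * (j + 1) / b * (((S.card - 1 : ℕ) - j : ℕ) : ℚ) / (j + 1) := by
            field_simp
        _ = ((ρ - κ) * a) * (j + 1) / b * (((S.card - 1 : ℕ) - j : ℕ) : ℚ) / (j + 1) := by rw [h1]
        _ = (ρ - κ) * (a * (((S.card - 1 : ℕ) - j : ℕ) : ℚ)) * (j + 1) / b / (j + 1) := by ring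
        _ = (ρ - κ) * (b * (j + 1)) * (j + 1) / b / (j + 1) := by rw [h2]
        _ = (j + 1) * (ρ - κ) := by field_simp
    · -- the `x`-half is the instance of `C ∖ x`
      rw [rowsLink_rowsOne hj hx hxC]
      have hC' : (C.erase x).card = m := by rw [card_erase_of_mem hxC, hC]; rfl
      have hCS' : C.erase x ⊆ S.erase x := erase_subset_erase x hCS
      have hn' : (j - 1) + 2 ≤ (S.erase x).card := by omega
      have htot' : ρ * (rowsOne (S.erase x) (j - 1) (C.erase x)).card = (ν - κ) * (cols (S.erase x) (j - 1)).card := by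
        rw [hL1, ← rowsLink_rowsOne hj hx hxC, ← ha_def]
        have : ((rowsLink (rowsOne S j C) x).card : ℚ) = (rowsOne S j C).card - a := by rw [hPsplit]; ring
        rw [this, mul_sub, htot, hLq]
        rw [sub_mul, hκa, ht_def]; ring
      refine hasFlow_congr (fun _ _ => rfl) ?_ (ih (S.erase x) (j - 1) (C.erase x) ρ (ν - κ) hC' hCS' (by omega) hn' hρ (by linarith) htot')
      intro Y hY
      rw [if_pos (cols_erase_subset_rowsOne hj hxC hY)]

/-- The tree's punctured level of the `j`-sets containing `C` (gen 33's `upLevel`) is `rowsOne univ j C`. -/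
theorem punctured_upLevel_eq [Fintype α] (j : ℕ) (C : Finset α) :
    punctured j (upLevel j C) = rowsOne univ j C := by
  ext X
  simp only [punctured, upLevel, rowsOne, mem_sdiff, mem_filter, mem_powersetCard, subset_univ, true_and]
  tauto

/-- **(SP) FOR ONE CO-HYPERPLANE, `j + 2 ≤ n`** — gen 33's `puncturedNMP_upLevel` by point splitting, with
`2j + 1 ≤ n` weakened to `j + 2 ≤ n`. -/
theorem puncturedNMP_upLevel_split [Fintype α] {j : ℕ} {C : Finset α} (hm : 1 ≤ C.card) (hmj : C.card ≤ j)
    (hn : j + 2 ≤ Fintype.card α) : PuncturedNMP j (upLevel j C) := by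
  apply puncturedNMP_of_hasFlow
  rw [punctured_upLevel_eq]
  have hPpos : 0 < (rowsOne univ j C).card := by
    obtain ⟨x, hx⟩ : C.Nonempty := card_pos.1 hm
    obtain ⟨X, hXsub, hXc⟩ := exists_subset_card_eq (s := (univ : Finset α).erase x) (n := j)
      (by rw [card_erase_of_mem (mem_univ x), card_univ]; omega)
    apply card_pos.2 ⟨X, ?_⟩
    rw [mem_rowsOne]
    refine ⟨subset_univ X, hXc, fun h => ?_⟩
    exact (mem_erase.1 (hXsub (h hx))).1 rfl
  have hLpos : 0 < (cols (univ : Finset α) j).card := by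
    rw [cols, card_powersetCard, card_univ]; exact Nat.choose_pos (by omega)
  have hP : (0 : ℚ) < (rowsOne (univ : Finset α) j C).card := by exact_mod_cast hPpos
  have hL : (0 : ℚ) < (cols (univ : Finset α) j).card := by exact_mod_cast hLpos
  have hcols : levelAbove α j = cols univ j := rfl
  rw [hcols]
  apply hasFlow_rowsOne C.card univ j C _ _ rfl (subset_univ C) hmj (by rw [card_univ]; exact hn)
    (by positivity) (by positivity)
  rw [one_div_mul_cancel hP.ne', one_div_mul_cancel hL.ne']

end PercRepro.PuncturedLYM.Split
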